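import Mathlib

/-!
# `cone_of_laplace_bound` — the measure-theoretic tail of `stub_cone_of_discSections`
(line `two-mirror-lightcone-slots`, crux stmt-QuantumFields-9664); drefute by-product,
refuter-drefute-stmt-QuantumFields-9664-0 (re-proof: cdisprove v3 proved a version in its
Disproof.lean, whose text is not mounted on this hub).

If `∫⁻ e^{−t p₀ + σ p₁} dμ ≤ M` for all `t > 0` and all `|σ| < t`, then `μ {p₀ < |p₁|} = 0`.
No finiteness or support hypothesis is needed in the `lintegral` form; a Bochner-integral corollary
(finite measure, integrable sections) is given at the end.
-/

noncomputable section

namespace DrefuteProofs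

open MeasureTheory Set Filter
open scoped ENNReal Topology

local notation "E4" => EuclideanSpace ℝ (Fin 4)

theorem continuous_coord (i : Fin 4) : Continuous fun p : E4 => p i :=
  (EuclideanSpace.proj i).continuous

/-- Chebyshev in exponential form: if `c ≤ g` on `B` and `∫⁻ e^{g} ≤ M` then `μ B ≤ M e^{−c}`. -/
theorem measure_le_of_lintegral_exp_le {μ : Measure E4} {g : E4 → ℝ} {B : Set E4}
    (hB : MeasurableSet B) {c M : ℝ} (hcB : ∀ p ∈ B, c ≤ g p)
    (hint : ∫⁻ p, ENNReal.ofReal (Real.exp (g p)) ∂μ ≤ ENNReal.ofReal M) :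
    μ B ≤ ENNReal.ofReal (M * Real.exp (-c)) := by
  have h1 : ENNReal.ofReal (Real.exp c) * μ B ≤ ENNReal.ofReal M := by
    calc ENNReal.ofReal (Real.exp c) * μ B
        = ∫⁻ _ in B, ENNReal.ofReal (Real.exp c) ∂μ := by rw [setLIntegral_const]
      _ ≤ ∫⁻ p in B, ENNReal.ofReal (Real.exp (g p)) ∂μ :=
          setLIntegral_mono' hB fun p hp => ENNReal.ofReal_le_ofReal (Real.exp_le_exp.2 (hcB p hp))
      _ ≤ ∫⁻ p, ENNReal.ofReal (Real.exp (g p)) ∂μ := setLIntegral_le_lintegral _ _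
      _ ≤ ENNReal.ofReal M := hint
  have hc : ENNReal.ofReal (Real.exp c) ≠ 0 := by
    rw [Ne, ENNReal.ofReal_eq_zero, not_le]
    exact Real.exp_pos c
  calc μ B = (ENNReal.ofReal (Real.exp c))⁻¹ * (ENNReal.ofReal (Real.exp c) * μ B) := by
        rw [← mul_assoc, ENNReal.inv_mul_cancel hc ENNReal.ofReal_ne_top, one_mul]
    _ ≤ (ENNReal.ofReal (Real.exp c))⁻¹ * ENNReal.ofReal M := by gcongr
    _ = ENNReal.ofReal (M * Real.exp (-c)) := by
        rw [← ENNReal.ofReal_inv_of_pos (Real.exp_pos c),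
          ← ENNReal.ofReal_mul (inv_nonneg.2 (Real.exp_pos c).le), Real.exp_neg, mul_comm]

/-- A quantity bounded by `M e^{−tδ}` for all `t > 0` (`δ > 0`) vanishes. -/
theorem eq_zero_of_forall_le_exp {a : ℝ≥0∞} {M δ : ℝ} (hδ : 0 < δ)
    (h : ∀ t : ℝ, 0 < t → a ≤ ENNReal.ofReal (M * Real.exp (-(t * δ)))) : a = 0 := by
  have hlim : Tendsto (fun t : ℝ => ENNReal.ofReal (M * Real.exp (-(t * δ)))) atTop (𝓝 0) := by
    have h1 : Tendsto (fun t : ℝ => Real.exp (-(t * δ))) atTop (𝓝 0) :=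
      Real.tendsto_exp_neg_atTop_nhds_zero.comp (tendsto_id.atTop_mul_const hδ)
    have h2 : Tendsto (fun t : ℝ => M * Real.exp (-(t * δ))) atTop (𝓝 0) := by
      simpa using h1.const_mul M
    simpa using ENNReal.tendsto_ofReal h2
  refine le_antisymm (ge_of_tendsto hlim ?_) bot_le
  exact Filter.eventually_atTop.2 ⟨1, fun t ht => h t (by linarith)⟩

/-- The wedge piece `{δ < κ p₁ − p₀}` (rational slope `|κ| < 1`, rational offset `δ > 0`). -/
def wedgePiece (κ δ : ℚ) : Set E4 := {p | (δ : ℝ) < κ * p 1 - p 0}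

theorem measurableSet_wedgePiece (κ δ : ℚ) : MeasurableSet (wedgePiece κ δ) :=
  measurableSet_lt measurable_const
    ((measurable_const.mul (continuous_coord 1).measurable).sub (continuous_coord 0).measurable)

/-- Each wedge piece is null under the uniform Laplace bound. -/
theorem measure_wedgePiece_eq_zero {μ : Measure E4} {M : ℝ}
    (hL : ∀ t : ℝ, 0 < t → ∀ σ : ℝ, |σ| < t →
      ∫⁻ p, ENNReal.ofReal (Real.exp (-(t * p 0) + σ * p 1)) ∂μ ≤ ENNReal.ofReal M)
    {κ δ : ℚ} (hκ : |(κ : ℝ)| < 1) (hδ : 0 < (δ : ℝ)) : μ (wedgePiece κ δ) = 0 := by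
  refine eq_zero_of_forall_le_exp (M := M) hδ fun t ht => ?_
  have hσ : |(κ : ℝ) * t| < t := by
    rw [abs_mul, abs_of_pos ht]
    calc |(κ : ℝ)| * t < 1 * t := mul_lt_mul_of_pos_right hκ ht
      _ = t := one_mul t
  refine measure_le_of_lintegral_exp_le (measurableSet_wedgePiece κ δ) (fun p hp => ?_) (hL t ht _ hσ)
  have hp' : (δ : ℝ) < κ * p 1 - p 0 := hp
  have : t * δ ≤ t * (κ * p 1 - p 0) := mul_le_mul_of_nonneg_left hp'.le ht.le
  linarith

/-- **cone_of_laplace_bound.** A `t`-uniform bound on the two-sided Laplace sections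
`∫⁻ e^{−tp₀+σp₁} dμ ≤ M` (`|σ| < t`) forces `μ` onto the closed cone `{p₀ ≥ |p₁|}`. -/
theorem cone_of_laplace_bound (μ : Measure E4) (M : ℝ)
    (hL : ∀ t : ℝ, 0 < t → ∀ σ : ℝ, |σ| < t →
      ∫⁻ p, ENNReal.ofReal (Real.exp (-(t * p 0) + σ * p 1)) ∂μ ≤ ENNReal.ofReal M) :
    μ {p | p 0 < |p 1|} = 0 := by
  classical
  -- cover the open wedge by countably many rational pieces
  have hcover : {p : E4 | p 0 < |p 1|} ⊆
      ⋃ q : ℚ × ℚ, if |(q.1 : ℝ)| < 1 ∧ 0 < (q.2 : ℝ) then wedgePiece q.1 q.2 else ∅ := by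
    intro p hp
    have hp : p 0 < |p 1| := hp
    -- a rational slope κ with |κ| < 1 and κ p₁ > p₀
    obtain ⟨κ, hκ1, hκ2⟩ : ∃ κ : ℚ, |(κ : ℝ)| < 1 ∧ p 0 < κ * p 1 := by
      rcases lt_trichotomy (p 1) 0 with h1 | h1 | h1
      · -- p₁ < 0 : need κ < p₀/p₁, and p₀/p₁ > −1
        have hq : (-1 : ℝ) < p 0 / p 1 := by
          rw [abs_of_neg h1] at hp
          rw [lt_div_iff_of_neg h1]; linarith
        obtain ⟨κ, hκa, hκb⟩ := exists_rat_btwn (lt_min hq (by norm_num : (-1 : ℝ) < 1))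
        refine ⟨κ, ?_, ?_⟩
        · rw [abs_lt]; exact ⟨hκa, lt_of_lt_of_le hκb (min_le_right _ _)⟩
        · have := lt_of_lt_of_le hκb (min_le_left _ _)
          rw [lt_div_iff_of_neg h1] at this; linarith
      · refine ⟨0, by simp, ?_⟩
        rw [h1, abs_zero] at hp
        simpa using hp
      · -- p₁ > 0 : need κ > p₀/p₁, and p₀/p₁ < 1
        have hq : p 0 / p 1 < 1 := by
          rw [abs_of_pos h1] at hp
          rw [div_lt_iff₀ h1]; linarith
        obtain ⟨κ, hκa, hκb⟩ := exists_rat_btwn (max_lt hq (by norm_num : (-1 : ℝ) < 1))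
        refine ⟨κ, ?_, ?_⟩
        · rw [abs_lt]; exact ⟨lt_of_le_of_lt (le_max_right _ _) hκa, hκb⟩
        · have := lt_of_le_of_lt (le_max_left _ _) hκa
          rw [div_lt_iff₀ h1] at this; linarith
    obtain ⟨δ, hδa, hδb⟩ := exists_rat_btwn (sub_pos.2 hκ2)
    refine mem_iUnion.2 ⟨(κ, δ), ?_⟩
    show p ∈ (if |(κ : ℝ)| < 1 ∧ 0 < (δ : ℝ) then wedgePiece κ δ else ∅)
    rw [if_pos ⟨hκ1, hδa⟩]
    exact hδb
  refine measure_mono_null hcover (measure_iUnion_null fun q => ?_)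
  split_ifs with hq
  · exact measure_wedgePiece_eq_zero hL hq.1 hq.2
  · exact measure_empty

/-- Bochner form (finite measure, integrable sections), as it comes out of the Lukacs step. -/
theorem cone_of_laplace_bound_integral (μ : Measure E4) [IsFiniteMeasure μ] (M : ℝ)
    (hI : ∀ t : ℝ, 0 < t → ∀ σ : ℝ, |σ| < t → Integrable (fun p : E4 => Real.exp (-(t * p 0) + σ * p 1)) μ)
    (hL : ∀ t : ℝ, 0 < t → ∀ σ : ℝ, |σ| < t → ∫ p, Real.exp (-(t * p 0) + σ * p 1) ∂μ ≤ M) :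
    μ {p | p 0 < |p 1|} = 0 := by
  refine cone_of_laplace_bound μ M fun t ht σ hσ => ?_
  rw [← ofReal_integral_eq_lintegral_ofReal (hI t ht σ hσ) (Eventually.of_forall fun p => (Real.exp_pos _).le)]
  exact ENNReal.ofReal_le_ofReal (hL t ht σ hσ)

end DrefuteProofs
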